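import Literature.NumberTheory.Automorphic.UnitaryGroupHyperbolicSwap
import Literature.RepresentationTheory.HeisenbergGroup.PolarisationMoverTwoRootFamilies
import Literature.RepresentationTheory.HeisenbergGroup.SymplecticDarbouxMover
import HarnessLib

/-!
# The polarisation mover of an integral hyperbolic pair of a diagonal hermitian form: the three conjugation identities
# (road δ of the cell `hodgecm-mathlib`, piece δ2-M; consumer: `UnitaryGroupOddLineNoIntegralEigenvector`)

Topic `NumberTheory/Automorphic`; namespaces `Literature.RepresentationTheory.HeisenbergGroup` (§0) and
`Literature.NumberTheory.Automorphic.UnitaryGroup` (§1–§2).  KERNEL ONLY: theorems; no definition, no named fact, no `sorry`.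

Setting (the tree's local currency of [GelbartRogawski1991, §3.1]: `E/F` quadratic, `c`, `δ` with `c δ = −δ ≠ 0`, `δ² = d`, a finite
place `v`, `E_v = LocalRing E v` with `σ = conjLocal`, the hermitian pairing `h = hermForm σ J_v` on `E_vᴺ`, the symplectic space
`𝕎_v = F_vᴺ × F_vᴺ` with `A = alt (polar β_T)`, `β_T = localPairing F N T v`, the embedding `ι_v = iota … : U(J)(F_v) → Sp(𝕎_v)` and the
coordinates `reIm` of `quadraticLocalEquiv`), for a DIAGONAL `T = diagonal tD` (`J = T ⊗ 1`) and a hyperbolic pair `(r, r′)` of `h`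
(`h(r,r) = h(r′,r′) = 0`, `h(r,r′) = 1`) supported on two coordinates `e′(inl 0), e′(inl 1)` of a splitting `e′ : Fin 2 ⊕ ι₂ ≃ Fin N`:

* §0 `HeisenbergGroup.exists_eq_leviSp_of_apply_inl` — LEVI RECOGNITION: a symplectic map acting on the Lagrangian `X × 0` through
  `a ∈ GL(X)` and carrying `0 × Y` into itself IS the Levi element `leviSp a d`, `β(a x, d y) = β(x, y)` being forced
  [Weil1964, n° 6; MoeglinVignerasWaldspurger1987, Chap. 2 II.6];
* §1 `hermForm_diagonal(_single_right/_left)`, `localFormS_eq_diagonal` — bookkeeping of diagonal Gram matrices;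
* §2 **`exists_mover_integralHyperbolicPair`** — the explicit Darboux family `x′ = (reIm r′, reIm δr′, reIm eₖ)`,
  `y′ = (reIm δr, −reIm r, reIm (tₖ⁻¹δ) eₖ)` (pairings computed from `A(reIm y, reIm x) = im h(y, x)`,
  ★ `alt_polar_localPairing_reIm`), its mover `g₀ ∈ Sp(𝕎_v)` (★ `exists_symplecticGroup_symm_apply_eq_sum`), and the THREE
  CONJUGATION IDENTITIES: (C1) `g₀ ι(n_{bδ}(r)) g₀⁻¹ = n(b • c₀)`, a Siegel unipotent whose second-degree datum on the `Fin 2`-block is the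
  NORM FORM `ξ₀² − d ξ₁²` (★ `conj_eq_unipotentSp_of_lower`, ★ `iota_localRootElt_apply`, ★ `localRootNil_reIm`);
  (C2) `g₀ ι(n_{bδ}(r′)) g₀⁻¹ = w · n(b • c₀′) · w⁻¹`, `w = partialWeyl` of the block, datum `ξ₁² − d ξ₀²` (★ `coe_conj_apply_of_upper`,
  ★ `coe_partialWeyl_conj_unipotentSp_apply`); (C3) every Levi dilation `D(α, β)` of the pair (★ `lineDilation`, `σ(α) β = 1`) becomes
  `leviSp a d` with `a` dilating the `Fin 2`-block of `X` by the multiplication matrix `Res(β) = (re β, d im β; im β, re β)` (§0).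

Written for the cell `hodgecm-mathlib` (fan F0∕P2, crux H413 = stmt-HodgeConjecture-24833, road δ = NSI-core′ in house, director s484;
F0P2-p01 (g4)).  Nothing about theta lifts is asserted; HC_CM is proved only modulo the printed citations until rung 0 closes.

## References
* [MoeglinVignerasWaldspurger1987] C. Mœglin, M.-F. Vignéras, J.-L. Waldspurger, LNM 1291 (1987), Chap. 1 I.17, Chap. 2 II.6, Chap. 3 §IV.2.
* [Weil1964] A. Weil, *Sur certains groupes d'opérateurs unitaires*, Acta Math. 111 (1964), n° 5–6, pp. 150–151.
* [Dieudonne1971GroupesClassiques] J. Dieudonné, *La géométrie des groupes classiques*, 3e éd. (1971), Chap. II §5.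
* [GelbartRogawski1991] S. Gelbart, J. Rogawski, Invent. Math. 105 (1991), §3.1 p. 454.
-/

set_option autoImplicit false

noncomputable section

open NumberField IsDedekindDomain Matrix
open scoped NNReal
open Literature.RepresentationTheory Literature.RepresentationTheory.HeisenbergGroup
open Literature.NumberTheory.Automorphic Literature.NumberTheory.Automorphic.UnitaryGroup
open Literature.NumberTheory.GaloisRepresentations.IsNonarchimedeanLocalField
open Literature.NumberTheory.GelbartRogawski1991.UnitaryDualPair.LocalSplitting

/-! ## §0 Recognising a Levi element of the Siegel parabolic -/

namespace Literature.RepresentationTheory.HeisenbergGroup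

section LeviRecognition

variable {R : Type*} [CommRing R] {X Y : Type*} [AddCommGroup X] [Module R X] [AddCommGroup Y] [Module R Y]
  (β : X →ₗ[R] Y →ₗ[R] R)

/-- **Levi recognition.** A symplectic `s` of `W = X × Y` acting on the Lagrangian `X × 0` through `a ∈ GL(X)` and
carrying `0 × Y` into itself IS the Levi element `m(a, d)`, `d y = (s (0, y)).2`, and `β(a x, d y) = β(x, y)` is forced by
`s` being symplectic. [cite: Weil1964, n° 6, p. 151] [cite: MoeglinVignerasWaldspurger1987, Chap. 2 II.6] -/
theorem exists_eq_leviSp_of_apply_inl (s : symplecticGroup (polar β)) (a : X ≃ₗ[R] X)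
    (hX : ∀ x, (s : (X × Y) ≃ₗ[R] (X × Y)) (x, 0) = (a x, 0))
    (hY : ∀ y, ((s : (X × Y) ≃ₗ[R] (X × Y)) (0, y)).1 = 0) :
    ∃ (d : Y ≃ₗ[R] Y) (had : ∀ x y, β (a x) (d y) = β x y),
      s = leviSp β a d had ∧ ∀ y, (s : (X × Y) ≃ₗ[R] (X × Y)) (0, y) = (0, d y) := by
  set σ : (X × Y) ≃ₗ[R] (X × Y) := (s : (X × Y) ≃ₗ[R] (X × Y)) with hσ
  -- `σ (0, y) = (0, (σ (0, y)).2)`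
  have hY0 : ∀ y, σ (0, y) = (0, (σ (0, y)).2) := fun y => Prod.ext (hY y) rfl
  -- the inverse also preserves `0 × Y`
  have hY' : ∀ y, (σ.symm (0, y)).1 = 0 := by
    intro y
    set p := σ.symm (0, y) with hp
    have h1 : σ p = (0, y) := by rw [hp, LinearEquiv.apply_symm_apply]
    have h2 : σ p = σ (p.1, 0) + σ (0, p.2) := by
      rw [← map_add, Prod.mk_add_mk, add_zero, zero_add]
    rw [hX, hY0, Prod.mk_add_mk, add_zero, zero_add] at h2
    have h3 : a p.1 = 0 := by
      have := congrArg Prod.fst (h1.symm.trans h2)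
      simpa [eq_comm] using this
    exact (map_eq_zero_iff a a.injective).1 h3
  have hY0' : ∀ y, σ.symm (0, y) = (0, (σ.symm (0, y)).2) := fun y => Prod.ext (hY' y) rfl
  -- the candidate `d`
  let d : Y ≃ₗ[R] Y :=
    { toFun := fun y => (σ (0, y)).2
      map_add' := fun y y' => by
        rw [show ((0 : X), y + y') = ((0 : X), y) + ((0 : X), y') by rw [Prod.mk_add_mk, add_zero], map_add, Prod.snd_add]
      map_smul' := fun c y => by
        rw [show ((0 : X), c • y) = c • ((0 : X), y) by rw [Prod.smul_mk, smul_zero], map_smul, Prod.smul_snd,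
          RingHom.id_apply]
      invFun := fun y => (σ.symm (0, y)).2
      left_inv := fun y => by
        have h : σ.symm (σ (0, y)) = (0, y) := LinearEquiv.symm_apply_apply σ _
        rw [hY0 y] at h
        have := congrArg Prod.snd h
        exact this
      right_inv := fun y => by
        have h : σ (σ.symm (0, y)) = (0, y) := LinearEquiv.apply_symm_apply σ _
        rw [hY0' y] at h
        have := congrArg Prod.snd h
        exact this }
  have hd : ∀ y, d y = (σ (0, y)).2 := fun _ => rfl
  have had : ∀ x y, β (a x) (d y) = β x y := by
    intro x y
    have hs := (mem_symplecticGroup (polar β) σ).1 s.2 (x, 0) (0, y)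
    rw [hX, hY0, polar_apply, polar_apply, polar_apply, polar_apply] at hs
    simpa [hd] using hs
  refine ⟨d, had, Subtype.ext (LinearEquiv.ext fun p => ?_), fun y => by rw [hY0, hd]⟩
  obtain ⟨x, y⟩ := p
  have h2 : σ (x, y) = σ (x, 0) + σ (0, y) := by rw [← map_add, Prod.mk_add_mk, add_zero, zero_add]
  rw [← hσ, h2, hX, hY0, coe_leviSp_apply, Prod.mk_add_mk, add_zero, zero_add]
  rfl

end LeviRecognition

end Literature.RepresentationTheory.HeisenbergGroup

/-! ## §1 The local unitary algebra at a place: diagonal forms, the hyperbolic pair and its Darboux family -/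

namespace Literature.NumberTheory.Automorphic.UnitaryGroup

section Diagonal

variable {S : Type*} [CommRing S] (σ : S →+* S) {n : Type*} [Fintype n] [DecidableEq n]

/-- `h(x, y) = Σᵢ σ(xᵢ) dᵢ yᵢ` for a diagonal Gram matrix. [cite: MoeglinVignerasWaldspurger1987, Chap. 1 I.17] -/
theorem hermForm_diagonal (dd : n → S) (x y : n → S) :
    hermForm σ (Matrix.diagonal dd) x y = ∑ i, σ (x i) * (dd i * y i) := by
  rw [hermForm_apply]
  simp only [dotProduct, Function.comp_apply, Matrix.mulVec_diagonal]

/-- `h(x, a eₖ) = σ(xₖ) dₖ a` for a diagonal Gram matrix. [cite: MoeglinVignerasWaldspurger1987, Chap. 1 I.17] -/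
theorem hermForm_diagonal_single_right (dd : n → S) (x : n → S) (k : n) (a : S) :
    hermForm σ (Matrix.diagonal dd) x (Pi.single k a) = σ (x k) * (dd k * a) := by
  rw [hermForm_diagonal]
  rw [Finset.sum_eq_single k]
  · rw [Pi.single_eq_same]
  · intro i _ hi; rw [Pi.single_eq_of_ne hi, mul_zero, mul_zero]
  · intro h; exact absurd (Finset.mem_univ k) h

/-- `h(a eₖ, y) = σ(a) dₖ yₖ` for a diagonal Gram matrix. [cite: MoeglinVignerasWaldspurger1987, Chap. 1 I.17] -/
theorem hermForm_diagonal_single_left (dd : n → S) (y : n → S) (k : n) (a : S) :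
    hermForm σ (Matrix.diagonal dd) (Pi.single k a) y = σ a * (dd k * y k) := by
  rw [hermForm_diagonal]
  rw [Finset.sum_eq_single k]
  · rw [Pi.single_eq_same]
  · intro i _ hi; rw [Pi.single_eq_of_ne hi, map_zero, zero_mul]
  · intro h; exact absurd (Finset.mem_univ k) h

end Diagonal

section Place

variable {F : Type} [Field F] [NumberField F] (E : Type) [Field E] [NumberField E] [Algebra F E]
  [Algebra.IsQuadraticExtension F E] (c : E ≃ₐ[F] E) (N : ℕ) (J : Matrix (Fin N) (Fin N) E)
  (v : HeightOneSpectrum (𝓞 F)) {δ : E} (hcδ : c δ = -δ) (hδ : δ ≠ 0) {d : F} (hd : δ * δ = algebraMap F E d)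
  (T : Matrix (Fin N) (Fin N) F) (hT : T.IsSymm) (hJ : J = T.map (algebraMap F E)) (tD : Fin N → F)
  (hTD : T = Matrix.diagonal tD)

omit [Algebra.IsQuadraticExtension F E] in
include hJ hTD in
/-- the local Gram matrix of a diagonal `T` is diagonal with entries `φ(tD i)` (`J_v = (T ⊗ 1)_v`). [cite: GelbartRogawski1991, §3.1 p. 454] -/
theorem localFormS_eq_diagonal :
    (adelicForm E N J).map (adeleToLocal E v) =
      Matrix.diagonal fun i => toLocalRing E v (algebraMap F (v.adicCompletion F) (tD i)) := by
  rw [localForm_eq_map E N v T hJ, hTD, Matrix.diagonal_map (map_zero _), Matrix.diagonal_map (map_zero _)]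

end Place

/-! ## §2 The Darboux family of an integral hyperbolic pair and the polarisation mover: the three conjugation identities -/

section Mover

variable {F : Type} [Field F] [NumberField F] (E : Type) [Field E] [NumberField E] [Algebra F E]
  [Algebra.IsQuadraticExtension F E] (c : E ≃ₐ[F] E) (N : ℕ) (J : Matrix (Fin N) (Fin N) E)
  (v : HeightOneSpectrum (𝓞 F)) {δ : E} (hcδ : c δ = -δ) (hδ : δ ≠ 0) {d : F} (hd : δ * δ = algebraMap F E d)
  (T : Matrix (Fin N) (Fin N) F) (hT : T.IsSymm) (hJ : J = T.map (algebraMap F E)) (hJh : (J.map c)ᵀ = J)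
  (tD : Fin N → F) (hTD : T = Matrix.diagonal tD) (htD0 : ∀ i, tD i ≠ 0)
  {ι₂ : Type} [Fintype ι₂] [DecidableEq ι₂] (e' : Fin 2 ⊕ ι₂ ≃ Fin N)
  {r r' : Fin N → LocalRing E v}
  (hr : hermForm (conjLocal E c v) ((adelicForm E N J).map (adeleToLocal E v)) r r = 0)
  (hr' : hermForm (conjLocal E c v) ((adelicForm E N J).map (adeleToLocal E v)) r' r' = 0)
  (hrr' : hermForm (conjLocal E c v) ((adelicForm E N J).map (adeleToLocal E v)) r r' = 1)
  (hsupp : ∀ j, r (e' (Sum.inr j)) = 0 ∧ r' (e' (Sum.inr j)) = 0)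

set_option maxHeartbeats 2000000 in
include hcδ hδ hd hT hJ hJh hTD htD0 hr hr' hrr' hsupp in
/-- **The polarisation mover of an integral hyperbolic pair `(r, r′)` of a DIAGONAL form, and the three conjugation
identities.**  With the Darboux family `x′ = (reIm r′, reIm δr′, reIm eₖ)`, `y′ = (reIm δr, −reIm r, reIm (tₖ⁻¹δ eₖ))`
(`k` off the pair) and its mover `g₀ ∈ Sp(𝕎_v)` (★ `exists_symplecticGroup_symm_apply_eq_sum`): `g₀` conjugates the root
elements `ι(n_{bδ}(r))` onto the Siegel unipotents `n(b • c₀)` whose second-degree datum on the `Fin 2`-block is the NORM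
FORM `ξ₀² − d ξ₁²`, the root elements `ι(n_{bδ}(r′))` onto the `partialWeyl`-conjugates of `n(b • c₀′)` with datum
`d ξ₀² − ξ₁²`, and the Levi dilations `D(α, β)` of the pair onto Levi elements acting on the `Fin 2`-block of `X` through the
multiplication matrix of `β`. [cite: MoeglinVignerasWaldspurger1987, Chap. 2 II.6, Chap. 3 §IV.2]
[cite: Weil1964, n° 6, p. 151] [cite: Dieudonne1971GroupesClassiques, Chap. II §5] -/
theorem exists_mover_integralHyperbolicPair :
    ∃ (g₀ : LocalSp F N T v)
      (c₀ c₀' : (Fin N → v.adicCompletion F) →ₗ[v.adicCompletion F] (Fin N → v.adicCompletion F))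
      (hc₀ : ∀ x x', localPairing F N T v x (c₀ x') = localPairing F N T v x' (c₀ x))
      (hc₀' : ∀ x x', localPairing F N T v x (c₀' x') = localPairing F N T v x' (c₀' x)),
      -- `c₀`, `c₀'` are supported on the `Fin 2`-block and their second-degree data are the two norm forms
      (∀ x, localPairing F N T v x (c₀ x) = (resL e' x 0) ^ 2 - (d : v.adicCompletion F) * (resL e' x 1) ^ 2) ∧
      (∀ x, localPairing F N T v x (c₀' x) = (resL e' x 1) ^ 2 - (d : v.adicCompletion F) * (resL e' x 0) ^ 2) ∧
      -- (C1) the root elements of `r` become Siegel unipotents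
      (∀ b : v.adicCompletion F,
        g₀ * iota F E c N hcδ hδ hd T hT hJ v (localRootElt E c N J v hcδ hδ hJh hr b) * g₀⁻¹ =
          unipotentSp (localPairing F N T v) (b • c₀) (symm_smul_of_symm (localPairing F N T v) c₀ hc₀ b)) ∧
      -- (C2) the root elements of `r′` become `partialWeyl`-conjugates of Siegel unipotents
      (∀ b : v.adicCompletion F,
        g₀ * iota F E c N hcδ hδ hd T hT hJ v (localRootElt E c N J v hcδ hδ hJh hr' b) * g₀⁻¹ =
          partialWeyl (localGram F N T v)
              (UnitaryGroup.isUnit_det_map (algebraMap F (v.adicCompletion F))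
                (by rw [hTD, Matrix.det_diagonal]; exact IsUnit.mk0 _ (Finset.prod_ne_zero_iff.2 fun i _ => htD0 i))) e' *
            unipotentSp (localPairing F N T v) (b • c₀') (symm_smul_of_symm (localPairing F N T v) c₀' hc₀' b) *
            (partialWeyl (localGram F N T v)
              (UnitaryGroup.isUnit_det_map (algebraMap F (v.adicCompletion F))
                (by rw [hTD, Matrix.det_diagonal]; exact IsUnit.mk0 _ (Finset.prod_ne_zero_iff.2 fun i _ => htD0 i))) e')⁻¹) ∧
      -- (C3) the Levi dilations of the pair become Levi elements dilating the `Fin 2`-block by the matrix of `β`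
      (∀ (α β : LocalRing E v), conjLocal E c v α * β = 1 → ∀ k : localPi E c N J v,
        ((localPiEquiv E c N J v k : «local» E c N J v) : GL (Fin N) (LocalRing E v)).val =
            lineDilation (conjLocal E c v) ((adelicForm E N J).map (adeleToLocal E v)) r r' α β →
          ∃ (a : (Fin N → v.adicCompletion F) ≃ₗ[v.adicCompletion F] (Fin N → v.adicCompletion F))
            (dY : (Fin N → v.adicCompletion F) ≃ₗ[v.adicCompletion F] (Fin N → v.adicCompletion F))
            (had : ∀ x y, localPairing F N T v (a x) (dY y) = localPairing F N T v x y),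
            g₀ * iota F E c N hcδ hδ hd T hT hJ v k * g₀⁻¹ = leviSp (localPairing F N T v) a dY had ∧
            ∀ x, a x = glue e'
              (QuadraticCoordinates.mulMatrixFun (quadraticLocalEquiv E v c hcδ hδ).toLinearEquiv.toAddEquiv
                (d : v.adicCompletion F) β *ᵥ resL e' x) (resR e' x)) := by
  classical
  -- ### abbreviations and basic facts
  have hq := isQuadraticCoordinates_local E v c hcδ hδ hd
  set Ψ := (quadraticLocalEquiv E v c hcδ hδ).toLinearEquiv.toAddEquiv with hΨ
  set σ := conjLocal E c v with hσdef
  set δ' : LocalRing E v := algebraMap E (LocalRing E v) δ with hδ'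
  set H := (adelicForm E N J).map (adeleToLocal E v) with hHdef
  set A := localGram F N T v with hAdef
  have hAeq : H = (T.map (algebraMap F (v.adicCompletion F))).map (toLocalRing E v) := localForm_eq_map E N v T hJ
  have hHdiag : H = Matrix.diagonal fun i => toLocalRing E v (algebraMap F (v.adicCompletion F) (tD i)) :=
    localFormS_eq_diagonal E N J v T hJ tD hTD
  have hAd : IsUnit A.det := by
    have : IsUnit T.det := by
      rw [hTD, Matrix.det_diagonal]; exact IsUnit.mk0 _ (Finset.prod_ne_zero_iff.2 fun i _ => htD0 i)
    exact UnitaryGroup.isUnit_det_map (algebraMap F (v.adicCompletion F)) this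
  have hσδ : σ δ' = -δ' := by rw [hσdef, hδ', conjLocal_algebraMap, hcδ, map_neg]
  have hδδ : δ' * δ' = toLocalRing E v (d : v.adicCompletion F) := hq.mul_self
  have hr'r : hermForm σ H r' r = 1 := hermForm_localGram_partner_symm E c N J v hcδ hδ hJh hrr'
  have htD0' : ∀ i, (algebraMap F (v.adicCompletion F) (tD i)) ≠ 0 := fun i =>
    (map_ne_zero (algebraMap F (v.adicCompletion F))).2 (htD0 i)
  -- support of `r`, `r'` off the pair
  have hrk : ∀ j, r (e' (Sum.inr j)) = 0 := fun j => (hsupp j).1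
  have hr'k : ∀ j, r' (e' (Sum.inr j)) = 0 := fun j => (hsupp j).2
  -- `h(u, eₖ)`-type evaluations for the diagonal `H`
  have hright : ∀ (u : Fin N → LocalRing E v) (k : Fin N) (a : LocalRing E v),
      hermForm σ H u (Pi.single k a) = σ (u k) * (toLocalRing E v (algebraMap F (v.adicCompletion F) (tD k)) * a) := by
    intro u k a; rw [hHdiag]; exact hermForm_diagonal_single_right σ _ u k a
  have hleft : ∀ (w : Fin N → LocalRing E v) (k : Fin N) (a : LocalRing E v),
      hermForm σ H (Pi.single k a) w = σ a * (toLocalRing E v (algebraMap F (v.adicCompletion F) (tD k)) * w k) := by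
    intro w k a; rw [hHdiag]; exact hermForm_diagonal_single_left σ _ w k a
  -- the pairing `A(reIm y, reIm x) = im h(y, x)`
  have hpair : ∀ y x : Fin N → LocalRing E v,
      alt (polar (localPairing F N T v)) (QuadraticCoordinates.reIm Ψ (Fin N) y) (QuadraticCoordinates.reIm Ψ (Fin N) x) =
        QuadraticCoordinates.im Ψ (hermForm σ H y x) := by
    intro y x; rw [hAeq]; exact alt_polar_localPairing_reIm E c hcδ hδ hd T hT v y x
  -- ### the Darboux vectors (opaque locals with defining equations, to keep `whnf` cheap)
  obtain ⟨xvS, hxvS⟩ : ∃ xvS : Fin 2 ⊕ ι₂ → Fin N → LocalRing E v,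
      xvS = Sum.elim ![r', δ' • r'] (fun j => Pi.single (e' (Sum.inr j)) 1) := ⟨_, rfl⟩
  obtain ⟨yvS, hyvS⟩ : ∃ yvS : Fin 2 ⊕ ι₂ → Fin N → LocalRing E v,
      yvS = Sum.elim ![δ' • r, -r] (fun j => Pi.single (e' (Sum.inr j))
        (toLocalRing E v ((algebraMap F (v.adicCompletion F) (tD (e' (Sum.inr j))))⁻¹) * δ')) := ⟨_, rfl⟩
  generalize hx'f : (fun i => QuadraticCoordinates.reIm Ψ (Fin N) (xvS (e'.symm i)) :
      Fin N → (Fin N → v.adicCompletion F) × (Fin N → v.adicCompletion F)) = x'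
  generalize hy'f : (fun i => QuadraticCoordinates.reIm Ψ (Fin N) (yvS (e'.symm i)) :
      Fin N → (Fin N → v.adicCompletion F) × (Fin N → v.adicCompletion F)) = y'
  have hx' : ∀ i, x' i = QuadraticCoordinates.reIm Ψ (Fin N) (xvS (e'.symm i)) := fun i => by rw [← hx'f]
  have hy' : ∀ i, y' i = QuadraticCoordinates.reIm Ψ (Fin N) (yvS (e'.symm i)) := fun i => by rw [← hy'f]
  -- values of the Darboux vectors
  have hx0 : xvS (Sum.inl 0) = r' := by rw [hxvS, Sum.elim_inl, Matrix.cons_val_zero]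
  have hx1 : xvS (Sum.inl 1) = δ' • r' := by rw [hxvS, Sum.elim_inl, Matrix.cons_val_one, Matrix.cons_val_fin_one]
  have hxj : ∀ j, xvS (Sum.inr j) = Pi.single (e' (Sum.inr j)) 1 := fun j => by rw [hxvS, Sum.elim_inr]
  have hy0 : yvS (Sum.inl 0) = δ' • r := by rw [hyvS, Sum.elim_inl, Matrix.cons_val_zero]
  have hy1 : yvS (Sum.inl 1) = -r := by rw [hyvS, Sum.elim_inl, Matrix.cons_val_one, Matrix.cons_val_fin_one]
  have hyj : ∀ j, yvS (Sum.inr j) = Pi.single (e' (Sum.inr j))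
      (toLocalRing E v ((algebraMap F (v.adicCompletion F) (tD (e' (Sum.inr j))))⁻¹) * δ') := fun j => by
    rw [hyvS, Sum.elim_inr]
  have hx'e : ∀ s, x' (e' s) = QuadraticCoordinates.reIm Ψ (Fin N) (xvS s) := fun s => by
    rw [hx', Equiv.symm_apply_apply]
  have hy'e : ∀ s, y' (e' s) = QuadraticCoordinates.reIm Ψ (Fin N) (yvS s) := fun s => by
    rw [hy', Equiv.symm_apply_apply]
  -- ### the hermitian pairings of the Darboux vectors
  -- `h(xvS s, xvS s') ∈ φ(F_v)` (in fact mostly `0`)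
  have im0 : QuadraticCoordinates.im Ψ (0 : LocalRing E v) = 0 := map_zero _
  have imφ : ∀ t : v.adicCompletion F, QuadraticCoordinates.im Ψ (toLocalRing E v t) = 0 := hq.im_map
  have hxx' : ∀ s s', QuadraticCoordinates.im Ψ (hermForm σ H (xvS s) (xvS s')) = 0 := by
    intro s s'
    rcases s with s | j <;> rcases s' with s' | j'
    · fin_cases s <;> fin_cases s'
      · simp only [hx0, Fin.zero_eta, Fin.isValue, hr', im0]
      · simp only [hx0, hx1, Fin.zero_eta, Fin.mk_one, Fin.isValue, hermForm_smul_right, hr', mul_zero, im0]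
      · simp only [hx0, hx1, Fin.zero_eta, Fin.mk_one, Fin.isValue, hermForm_smul_left_eq, hr', mul_zero, im0]
      · simp only [hx1, Fin.mk_one, Fin.isValue, hermForm_smul_left_eq, hermForm_smul_right, hr', mul_zero, im0]
    · fin_cases s
      · simp only [hx0, hxj, Fin.zero_eta, Fin.isValue, hright, hr'k, map_zero, zero_mul, im0]
      · simp only [hx1, hxj, Fin.mk_one, Fin.isValue, hright, Pi.smul_apply, smul_eq_mul, hr'k, mul_zero, map_zero,
          zero_mul, im0]
    · fin_cases s'
      · simp only [hx0, hxj, Fin.zero_eta, Fin.isValue, hleft, hr'k, mul_zero, im0]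
      · simp only [hx1, hxj, Fin.mk_one, Fin.isValue, hleft, Pi.smul_apply, smul_eq_mul, hr'k, mul_zero, im0]
    · simp only [hxj, hleft, map_one, one_mul]
      by_cases hjj : j = j'
      · subst hjj; rw [Pi.single_eq_same, mul_one, imφ]
      · rw [Pi.single_eq_of_ne (fun h => hjj (Sum.inr_injective (e'.injective h))), mul_zero, im0]

  -- conj facts
  have hσφ : ∀ t : v.adicCompletion F, σ (toLocalRing E v t) = toLocalRing E v t := fun t => by
    rw [hσdef, conjLocal_toLocalRing]
  have hσγ : ∀ j, σ (toLocalRing E v ((algebraMap F (v.adicCompletion F) (tD (e' (Sum.inr j))))⁻¹) * δ') =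
      -(toLocalRing E v ((algebraMap F (v.adicCompletion F) (tD (e' (Sum.inr j))))⁻¹) * δ') := fun j => by
    rw [map_mul, hσφ, hσδ, mul_neg]
  have imδ : QuadraticCoordinates.im Ψ δ' = 1 := hq.im_delta
  have hyy' : ∀ s s', QuadraticCoordinates.im Ψ (hermForm σ H (yvS s) (yvS s')) = 0 := by
    intro s s'
    rcases s with s | j <;> rcases s' with s' | j'
    · fin_cases s <;> fin_cases s'
      · simp only [hy0, Fin.zero_eta, Fin.isValue, hermForm_smul_left_eq, hermForm_smul_right, hr, mul_zero, im0]
      · simp only [hy0, hy1, Fin.zero_eta, Fin.mk_one, Fin.isValue, hermForm_smul_left_eq, hermForm_neg_right, hr,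
          neg_zero, mul_zero, im0]
      · simp only [hy0, hy1, Fin.zero_eta, Fin.mk_one, Fin.isValue, hermForm_neg_left, hermForm_smul_right, hr, mul_zero,
          neg_zero, im0]
      · simp only [hy1, Fin.mk_one, Fin.isValue, hermForm_neg_left, hermForm_neg_right, hr, neg_zero, im0]
    · fin_cases s
      · simp only [hy0, hyj, Fin.zero_eta, Fin.isValue, hright, Pi.smul_apply, smul_eq_mul, hrk, mul_zero, map_zero,
          zero_mul, im0]
      · simp only [hy1, hyj, Fin.mk_one, Fin.isValue, hright, Pi.neg_apply, hrk, neg_zero, map_zero, zero_mul, im0]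
    · fin_cases s'
      · simp only [hy0, hyj, Fin.zero_eta, Fin.isValue, hleft, Pi.smul_apply, smul_eq_mul, hrk, mul_zero, im0]
      · simp only [hy1, hyj, Fin.mk_one, Fin.isValue, hleft, Pi.neg_apply, hrk, neg_zero, mul_zero, im0]
    · simp only [hyj, hleft]
      by_cases hjj : j = j'
      · subst hjj
        -- `-(φ(t⁻¹) δ) * (φ t * (φ(t⁻¹) δ)) = φ(-(t⁻¹ t t⁻¹ d))`
        have key : ∀ a b e : v.adicCompletion F,
            -(toLocalRing E v a * δ') * (toLocalRing E v b * (toLocalRing E v e * δ')) =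
              toLocalRing E v (-(a * b * e * (d : v.adicCompletion F))) := by
          intro a b e
          rw [map_neg, map_mul, map_mul, map_mul, ← hδδ]; ring
        rw [Pi.single_eq_same, hσγ, key, imφ]
      · rw [Pi.single_eq_of_ne (fun h => hjj (Sum.inr_injective (e'.injective h))), mul_zero, mul_zero, im0]
  -- the cross pairings `im h(xvS s, yvS s') = [s = s']`
  have im1 : QuadraticCoordinates.im Ψ (1 : LocalRing E v) = 0 := hq.im_one
  have hxy' : ∀ s s', QuadraticCoordinates.im Ψ (hermForm σ H (xvS s) (yvS s')) = if s = s' then 1 else 0 := by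
    intro s s'
    rcases s with s | j <;> rcases s' with s' | j'
    · fin_cases s <;> fin_cases s'
      · simp only [hx0, hy0, Fin.zero_eta, Fin.isValue, hermForm_smul_right, hr'r, mul_one, imδ, if_true]
      · simp only [hx0, hy1, Fin.zero_eta, Fin.mk_one, Fin.isValue, hermForm_neg_right, hr'r, map_neg, im1, neg_zero,
          Sum.inl.injEq, zero_ne_one, if_false]
      · simp only [hx1, hy0, Fin.zero_eta, Fin.mk_one, Fin.isValue, hermForm_smul_left_eq, hermForm_smul_right, hr'r,
          mul_one, hσδ, mul_neg, hδδ, map_neg, imφ, neg_zero, Sum.inl.injEq, one_ne_zero, if_false]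
      · simp only [hx1, hy1, Fin.mk_one, Fin.isValue, hermForm_smul_left_eq, hermForm_neg_right, hr'r, hσδ,
          mul_one, neg_neg, imδ, if_true]
    · fin_cases s
      · simp only [hx0, hyj, Fin.zero_eta, Fin.isValue, hright, hr'k, map_zero, zero_mul, im0, reduceCtorEq, if_false]
      · simp only [hx1, hyj, Fin.mk_one, Fin.isValue, hright, Pi.smul_apply, smul_eq_mul, hr'k, mul_zero, map_zero,
          zero_mul, im0, reduceCtorEq, if_false]
    · fin_cases s'
      · simp only [hy0, hxj, Fin.zero_eta, Fin.isValue, hleft, Pi.smul_apply, smul_eq_mul, hrk, mul_zero, im0,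
          reduceCtorEq, if_false]
      · simp only [hy1, hxj, Fin.mk_one, Fin.isValue, hleft, Pi.neg_apply, hrk, neg_zero, mul_zero, im0, reduceCtorEq,
          if_false]
    · simp only [hxj, hyj, hleft, map_one, one_mul]
      by_cases hjj : j = j'
      · subst hjj
        rw [Pi.single_eq_same, ← mul_assoc, ← map_mul, mul_inv_cancel₀ (htD0' _), map_one, one_mul, imδ, if_pos rfl]
      · rw [Pi.single_eq_of_ne (fun h => hjj (Sum.inr_injective (e'.injective h))), mul_zero, im0,
          if_neg (fun h => hjj (Sum.inr_injective h))]

  -- ### the Darboux relations and the mover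
  have hxx : ∀ i j, alt (polar (localPairing F N T v)) (x' i) (x' j) = 0 := by
    intro i j
    obtain ⟨s, rfl⟩ := e'.surjective i
    obtain ⟨s', rfl⟩ := e'.surjective j
    rw [hx'e, hx'e, hpair, hxx']
  have hyy : ∀ i j, alt (polar (localPairing F N T v)) (y' i) (y' j) = 0 := by
    intro i j
    obtain ⟨s, rfl⟩ := e'.surjective i
    obtain ⟨s', rfl⟩ := e'.surjective j
    rw [hy'e, hy'e, hpair, hyy']
  have hxy : ∀ i j, alt (polar (localPairing F N T v)) (x' i) (y' j) = if i = j then 1 else 0 := by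
    intro i j
    obtain ⟨s, rfl⟩ := e'.surjective i
    obtain ⟨s', rfl⟩ := e'.surjective j
    rw [hx'e, hy'e, hpair, hxy']
    simp only [e'.apply_eq_iff_eq]
  obtain ⟨g₀, hg₀⟩ := exists_symplecticGroup_symm_apply_eq_sum A x' y' hxx hyy hxy hAd
  -- ### the root nilpotents on the Darboux family
  -- the diagonal coefficient vectors of the two blocks
  generalize hnD : (fun i => Sum.elim ![(1 : v.adicCompletion F), -(d : v.adicCompletion F)] (fun _ => 0) (e'.symm i) :
      Fin N → v.adicCompletion F) = nD
  generalize hnD' : (fun i => Sum.elim ![(d : v.adicCompletion F), -1] (fun _ => 0) (e'.symm i) :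
      Fin N → v.adicCompletion F) = nD'
  have hnD0 : nD (e' (Sum.inl 0)) = 1 := by rw [← hnD]; simp
  have hnD1 : nD (e' (Sum.inl 1)) = -(d : v.adicCompletion F) := by rw [← hnD]; simp
  have hnDj : ∀ j, nD (e' (Sum.inr j)) = 0 := fun j => by rw [← hnD]; simp
  have hnD'0 : nD' (e' (Sum.inl 0)) = (d : v.adicCompletion F) := by rw [← hnD']; simp
  have hnD'1 : nD' (e' (Sum.inl 1)) = -1 := by rw [← hnD']; simp
  have hnD'j : ∀ j, nD' (e' (Sum.inr j)) = 0 := fun j => by rw [← hnD']; simp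
  -- `𝔫_r` is LOWER: `𝔫_r x'ᵢ = nD i • y'ᵢ`, `𝔫_r y'ⱼ = 0`
  have hNrx : ∀ i, localRootNil E c N J v hcδ hδ hd r (x' i) = ∑ j, Matrix.diagonal nD j i • y' j := by
    intro i
    rw [Finset.sum_eq_single i (fun j _ hji => by rw [Matrix.diagonal_apply_ne _ hji, zero_smul])
      (fun h => absurd (Finset.mem_univ i) h), Matrix.diagonal_apply_eq]
    obtain ⟨s, rfl⟩ := e'.surjective i
    rw [hx'e, hy'e, localRootNil_reIm]
    rcases s with s | j
    · fin_cases s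
      · rw [Fin.zero_eta, hx0, hy0, hnD0, hrr', mul_one, one_smul]
      · rw [Fin.mk_one, hx1, hy1, hnD1, hermForm_smul_right, hrr', mul_one, hδδ, reIm_toLocalRing_smul E c N v hcδ hδ hd,
          map_neg, smul_neg, neg_smul, neg_neg]
    · rw [hxj, hnDj, hright, hrk, map_zero, zero_mul, mul_zero, zero_smul, map_zero, zero_smul]
  have hNry : ∀ j, localRootNil E c N J v hcδ hδ hd r (y' j) = 0 := by
    intro j
    obtain ⟨s, rfl⟩ := e'.surjective j
    rw [hy'e, localRootNil_reIm]
    rcases s with s | j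
    · fin_cases s
      · rw [Fin.zero_eta, hy0, hermForm_smul_right, hr, mul_zero, mul_zero, zero_smul, map_zero]
      · rw [Fin.mk_one, hy1, hermForm_neg_right, hr, neg_zero, mul_zero, zero_smul, map_zero]
    · rw [hyj, hright, hrk, map_zero, zero_mul, mul_zero, zero_smul, map_zero]
  -- `𝔫_{r'}` is UPPER: `𝔫_{r'} y'ⱼ = nD' j • x'ⱼ`, `𝔫_{r'} x'ᵢ = 0`
  have hNr'y : ∀ j, localRootNil E c N J v hcδ hδ hd r' (y' j) = ∑ i, Matrix.diagonal nD' i j • x' i := by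
    intro j
    rw [Finset.sum_eq_single j (fun i _ hij => by rw [Matrix.diagonal_apply_ne _ hij, zero_smul])
      (fun h => absurd (Finset.mem_univ j) h), Matrix.diagonal_apply_eq]
    obtain ⟨s, rfl⟩ := e'.surjective j
    rw [hx'e, hy'e, localRootNil_reIm]
    rcases s with s | j
    · fin_cases s
      · rw [Fin.zero_eta, hx0, hy0, hnD'0, hermForm_smul_right, hr'r, mul_one, hδδ,
          reIm_toLocalRing_smul E c N v hcδ hδ hd]
      · rw [Fin.mk_one, hx1, hy1, hnD'1, hermForm_neg_right, hr'r, mul_neg, mul_one, neg_smul, map_neg, neg_smul, one_smul]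
    · rw [hyj, hnD'j, hright, hr'k, map_zero, zero_mul, mul_zero, zero_smul, map_zero, zero_smul]
  have hNr'x : ∀ i, localRootNil E c N J v hcδ hδ hd r' (x' i) = 0 := by
    intro i
    obtain ⟨s, rfl⟩ := e'.surjective i
    rw [hx'e, localRootNil_reIm]
    rcases s with s | j
    · fin_cases s
      · rw [Fin.zero_eta, hx0, hr', mul_zero, zero_smul, map_zero]
      · rw [Fin.mk_one, hx1, hermForm_smul_right, hr', mul_zero, mul_zero, zero_smul, map_zero]
    · rw [hxj, hright, hr'k, map_zero, zero_mul, mul_zero, zero_smul, map_zero]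

  -- ### the two Siegel data `c₀ = A⁻¹ N`, `c₀' = −A⁻¹ N'` and their second-degree forms
  haveI : CharZero (v.adicCompletion F) := charZero_of_injective_algebraMap (algebraMap F (v.adicCompletion F)).injective
  have hNsymm : (Matrix.diagonal nD).IsSymm := Matrix.isSymm_diagonal _
  have hN'symm : (-Matrix.diagonal nD').IsSymm := (Matrix.isSymm_diagonal _).neg
  have hc₀ : ∀ x x', localPairing F N T v x (Matrix.toLin' (A⁻¹ * Matrix.diagonal nD) x') =
      localPairing F N T v x' (Matrix.toLin' (A⁻¹ * Matrix.diagonal nD) x) := fun x x' => by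
    simpa only [one_smul] using toLinearMap₂'_smul_toLin'_inv_mul_symm hAd hNsymm 1 x x'
  have hc₀' : ∀ x x', localPairing F N T v x (Matrix.toLin' (A⁻¹ * -Matrix.diagonal nD') x') =
      localPairing F N T v x' (Matrix.toLin' (A⁻¹ * -Matrix.diagonal nD') x) := fun x x' => by
    simpa only [one_smul] using toLinearMap₂'_smul_toLin'_inv_mul_symm hAd hN'symm 1 x x'
  -- block structure of the diagonal vectors
  have hsum : ∀ f : Fin N → v.adicCompletion F, ∑ i, f i = f (e' (Sum.inl 0)) + f (e' (Sum.inl 1)) + ∑ j, f (e' (Sum.inr j)) := by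
    intro f
    rw [← e'.sum_comp, Fintype.sum_sum_type, Fin.sum_univ_two]
  have hQ₀ : ∀ x, localPairing F N T v x (Matrix.toLin' (A⁻¹ * Matrix.diagonal nD) x) =
      (resL e' x 0) ^ 2 - (d : v.adicCompletion F) * (resL e' x 1) ^ 2 := by
    intro x
    rw [toLinearMap₂'_toLin'_inv_mul hAd, dotProduct, hsum]
    simp only [Matrix.mulVec_diagonal, hnD0, hnD1, hnDj, zero_mul, mul_zero, Finset.sum_const_zero, add_zero, resL_apply]
    ring
  have hQ₀' : ∀ x, localPairing F N T v x (Matrix.toLin' (A⁻¹ * -Matrix.diagonal nD') x) =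
      (resL e' x 1) ^ 2 - (d : v.adicCompletion F) * (resL e' x 0) ^ 2 := by
    intro x
    rw [toLinearMap₂'_toLin'_inv_mul hAd, dotProduct, hsum]
    simp only [Matrix.neg_mulVec, Pi.neg_apply, Matrix.mulVec_diagonal, hnD'0, hnD'1, hnD'j, zero_mul, mul_zero,
      neg_zero, Finset.sum_const_zero, add_zero, resL_apply]
    ring
  -- `N' *ᵥ x` lives on the `Fin 2`-block
  have hN'glue : ∀ x : Fin N → v.adicCompletion F,
      Matrix.diagonal nD' *ᵥ x = glue e' (Matrix.diagonal ![(d : v.adicCompletion F), -1] *ᵥ resL e' x) 0 := by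
    intro x
    funext k
    obtain ⟨s, rfl⟩ := e'.surjective k
    rw [Matrix.mulVec_diagonal]
    rcases s with s | j
    · rw [glue_apply_inl, Matrix.mulVec_diagonal, resL_apply]
      fin_cases s
      · rw [Fin.zero_eta, hnD'0]; rfl
      · rw [Fin.mk_one, hnD'1]; rfl
    · rw [glue_apply_inr, hnD'j, zero_mul, Pi.zero_apply]
  have neg_glue0 : ∀ a : Fin 2 → v.adicCompletion F, -glue e' a (0 : ι₂ → v.adicCompletion F) = glue e' (-a) 0 := by
    intro a
    rw [← neg_one_smul (v.adicCompletion F) (glue e' a (0 : ι₂ → v.adicCompletion F)), smul_glue₁₂, neg_one_smul, smul_zero]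
  refine ⟨g₀, Matrix.toLin' (A⁻¹ * Matrix.diagonal nD), Matrix.toLin' (A⁻¹ * -Matrix.diagonal nD'), hc₀, hc₀', hQ₀, hQ₀',
    fun b => ?_, fun b => ?_, ?_⟩
  · -- (C1)
    exact conj_eq_unipotentSp_of_lower g₀ hg₀ hAd (localRootNil E c N J v hcδ hδ hd r) (Matrix.diagonal nD) hNrx hNry
      _ b (iota_localRootElt_apply E c N J v hcδ hδ hd T hT hJ hJh hr b)
      (toLinearMap₂'_smul_toLin'_inv_mul_symm hAd hNsymm b)
  · -- (C2)
    refine Subtype.ext (LinearEquiv.ext fun p => ?_)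
    rw [coe_conj_apply_of_upper g₀ hg₀ (localRootNil E c N J v hcδ hδ hd r') (Matrix.diagonal nD') hNr'y hNr'x _ b
      (iota_localRootElt_apply E c N J v hcδ hδ hd T hT hJ hJh hr' b) p]
    rw [coe_partialWeyl_conj_unipotentSp_apply A hAd e' (b • Matrix.toLin' (A⁻¹ * -Matrix.diagonal nD')) _
      (b • Matrix.toLin' (-Matrix.diagonal ![(d : v.adicCompletion F), -1])) (fun x => ?_) p]
    · refine Prod.ext ?_ rfl
      change p.1 + b • ((Matrix.diagonal nD' * A) *ᵥ p.2) =
        p.1 - glue e' ((b • Matrix.toLin' (-Matrix.diagonal ![(d : v.adicCompletion F), -1])) (resL e' (A *ᵥ p.2))) 0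
      rw [← Matrix.mulVec_mulVec, hN'glue, smul_glue₁₂, smul_zero, LinearMap.smul_apply, Matrix.toLin'_apply,
        Matrix.neg_mulVec, smul_neg, ← neg_glue0, sub_neg_eq_add]
    · rw [LinearMap.smul_apply, Matrix.mulVec_smul, Matrix.toLin'_apply, Matrix.mulVec_mulVec, ← Matrix.mul_assoc,
        Matrix.mul_nonsing_inv _ hAd, Matrix.one_mul, Matrix.neg_mulVec, hN'glue, LinearMap.smul_apply,
        Matrix.toLin'_apply, Matrix.neg_mulVec, smul_neg, smul_glue₁₂, smul_zero, neg_glue0, smul_neg]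
  · -- (C3)
    intro α β hαβ k hk
    have hσσ : ∀ z : LocalRing E v, σ (σ z) = z := fun z => by
      rw [hσdef]; exact Liu2021.LemD1OfPlace.conjLocal_conjLocal_apply E v c hcδ hδ z
    have hβα : β * σ α = 1 := by rw [mul_comm]; exact hαβ
    have hασ : σ α * β = 1 := hαβ
    -- the action of `ι(k)` through the dilation matrix
    have hιk : ∀ u : Fin N → LocalRing E v,
        ((iota F E c N hcδ hδ hd T hT hJ v k : LocalSp F N T v) :
            ((Fin N → v.adicCompletion F) × (Fin N → v.adicCompletion F)) ≃ₗ[v.adicCompletion F]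
              ((Fin N → v.adicCompletion F) × (Fin N → v.adicCompletion F))) (QuadraticCoordinates.reIm Ψ (Fin N) u) =
          QuadraticCoordinates.reIm Ψ (Fin N) (lineDilation σ H r r' α β *ᵥ u) := by
      intro u
      have hk' : k = (localPiEquiv E c N J v).symm (localPiEquiv E c N J v k) :=
        (ContinuousMulEquiv.symm_apply_apply _ _).symm
      rw [hk', iota_localPiEquiv_symm_reIm E c hcδ hδ hd T hT hJ v, hk]
    -- scalar decomposition `reIm (z • u) = re z • reIm u + im z • reIm (δ' • u)`
    have hreIm_smul : ∀ (z : LocalRing E v) (u : Fin N → LocalRing E v),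
        QuadraticCoordinates.reIm Ψ (Fin N) (z • u) =
          QuadraticCoordinates.re Ψ z • QuadraticCoordinates.reIm Ψ (Fin N) u +
            QuadraticCoordinates.im Ψ z • QuadraticCoordinates.reIm Ψ (Fin N) (δ' • u) := by
      intro z u
      conv_lhs => rw [← hq.re_add_im z]
      rw [add_smul, map_add, mul_smul, reIm_toLocalRing_smul E c N v hcδ hδ hd, reIm_toLocalRing_smul E c N v hcδ hδ hd]
    have hreδ : ∀ z : LocalRing E v, QuadraticCoordinates.re Ψ (δ' * z) = (d : v.adicCompletion F) * QuadraticCoordinates.im Ψ z :=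
      fun z => by rw [hq.re_mul, hq.re_delta, hq.im_delta, zero_mul, one_mul, zero_add]
    have himδ : ∀ z : LocalRing E v, QuadraticCoordinates.im Ψ (δ' * z) = QuadraticCoordinates.re Ψ z :=
      fun z => by rw [hq.im_mul, hq.re_delta, hq.im_delta, zero_mul, one_mul, zero_add]
    -- the dilation on the Darboux vectors
    have hDr' : lineDilation σ H r r' α β *ᵥ r' = β • r' := lineDilation_mulVec_partner σ H α β hr' hrr'
    have hDr : lineDilation σ H r r' α β *ᵥ r = α • r := lineDilation_mulVec_left σ H α β hr hr'r
    have hDe' : ∀ (j) (z : LocalRing E v), lineDilation σ H r r' α β *ᵥ (Pi.single (e' (Sum.inr j)) z) =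
        Pi.single (e' (Sum.inr j)) z := fun j z =>
      lineDilation_mulVec_of_orth σ H α β (by rw [hright, hrk, map_zero, zero_mul]) (by rw [hright, hr'k, map_zero, zero_mul])
    -- `ι(k)` on the `x'`-family: `ι(k) x'_{inl 0} = re β • x'₀ + im β • x'₁`, `ι(k) x'_{inl 1} = d im β • x'₀ + re β • x'₁`, `ι(k) x'ⱼ = x'ⱼ`
    have hkx0 : ((iota F E c N hcδ hδ hd T hT hJ v k : LocalSp F N T v) : ((Fin N → v.adicCompletion F) × (Fin N → v.adicCompletion F)) ≃ₗ[v.adicCompletion F] ((Fin N → v.adicCompletion F) × (Fin N → v.adicCompletion F))) (x' (e' (Sum.inl 0))) =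
        QuadraticCoordinates.re Ψ β • x' (e' (Sum.inl 0)) + QuadraticCoordinates.im Ψ β • x' (e' (Sum.inl 1)) := by
      rw [hx'e, hx'e, hx0, hx1, hιk, hDr', hreIm_smul]
    have hkx1 : ((iota F E c N hcδ hδ hd T hT hJ v k : LocalSp F N T v) : ((Fin N → v.adicCompletion F) × (Fin N → v.adicCompletion F)) ≃ₗ[v.adicCompletion F] ((Fin N → v.adicCompletion F) × (Fin N → v.adicCompletion F))) (x' (e' (Sum.inl 1))) =
        ((d : v.adicCompletion F) * QuadraticCoordinates.im Ψ β) • x' (e' (Sum.inl 0)) +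
          QuadraticCoordinates.re Ψ β • x' (e' (Sum.inl 1)) := by
      rw [hx'e, hx'e, hx0, hx1, hιk, Matrix.mulVec_smul, hDr', smul_smul, hreIm_smul, hreδ, himδ]
    have hkxj : ∀ j, ((iota F E c N hcδ hδ hd T hT hJ v k : LocalSp F N T v) : ((Fin N → v.adicCompletion F) × (Fin N → v.adicCompletion F)) ≃ₗ[v.adicCompletion F] ((Fin N → v.adicCompletion F) × (Fin N → v.adicCompletion F))) (x' (e' (Sum.inr j))) =
        x' (e' (Sum.inr j)) := fun j => by rw [hx'e, hxj, hιk, hDe']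
    -- `ι(k)` keeps the span of the `y'`-family (first components stay `0` after `g₀`)
    have hky : ∀ s, ∃ a₀ a₁ : v.adicCompletion F,
        ((iota F E c N hcδ hδ hd T hT hJ v k : LocalSp F N T v) : ((Fin N → v.adicCompletion F) × (Fin N → v.adicCompletion F)) ≃ₗ[v.adicCompletion F] ((Fin N → v.adicCompletion F) × (Fin N → v.adicCompletion F))) (y' (e' s)) =
          a₀ • y' (e' (Sum.inl 0)) + a₁ • y' (e' (Sum.inl 1)) + (if ∃ j, s = Sum.inr j then y' (e' s) else 0) := by
      intro s
      rcases s with s | j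
      · fin_cases s
        · refine ⟨QuadraticCoordinates.im Ψ (δ' * α), -QuadraticCoordinates.re Ψ (δ' * α), ?_⟩
          rw [Fin.zero_eta, hy'e, hy'e, hy0, hy1, hιk, Matrix.mulVec_smul, hDr, smul_smul, hreIm_smul, map_neg,
            smul_neg, neg_smul, neg_neg]
          simp only [Fin.isValue, reduceCtorEq, exists_false, if_false, add_zero]
          rw [add_comm]
        · refine ⟨-QuadraticCoordinates.im Ψ α, QuadraticCoordinates.re Ψ α, ?_⟩
          rw [Fin.mk_one, hy'e, hy'e, hy0, hy1, hιk, Matrix.mulVec_neg, hDr, map_neg, hreIm_smul, map_neg,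
            smul_neg, neg_smul]
          simp only [Fin.isValue, reduceCtorEq, exists_false, if_false, add_zero, neg_add]
          rw [add_comm]
      · refine ⟨0, 0, ?_⟩
        rw [hy'e, hyj, hιk, hDe']
        simp only [zero_smul, zero_add]
        rw [if_pos ⟨j, rfl⟩]
    -- the candidate Levi map `a` on `X = F_vᴺ`
    set Mβ : Matrix (Fin 2) (Fin 2) (v.adicCompletion F) :=
      QuadraticCoordinates.mulMatrixFun Ψ (d : v.adicCompletion F) β with hMβ
    set Mα : Matrix (Fin 2) (Fin 2) (v.adicCompletion F) :=
      QuadraticCoordinates.mulMatrixFun Ψ (d : v.adicCompletion F) (σ α) with hMα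
    have hMM : Mα * Mβ = 1 := by
      rw [hMα, hMβ, ← hq.mulMatrix_apply, ← hq.mulMatrix_apply, ← map_mul, hασ, map_one]
    have hMM' : Mβ * Mα = 1 := by
      rw [hMα, hMβ, ← hq.mulMatrix_apply, ← hq.mulMatrix_apply, ← map_mul, hβα, map_one]
    let aL : (Fin N → v.adicCompletion F) ≃ₗ[v.adicCompletion F] (Fin N → v.adicCompletion F) :=
      { toFun := fun x => glue e' (Mβ *ᵥ resL e' x) (resR e' x)
        map_add' := fun x y => by
          rw [resL_add, resR_add, Matrix.mulVec_add, glue_add]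
        map_smul' := fun t x => by
          rw [RingHom.id_apply, smul_glue₁₂, ← Matrix.mulVec_smul]; rfl
        invFun := fun x => glue e' (Mα *ᵥ resL e' x) (resR e' x)
        left_inv := fun x => by
          simp only [resL_glue, resR_glue, Matrix.mulVec_mulVec, hMM, Matrix.one_mulVec, glue_resL_resR]
        right_inv := fun x => by
          simp only [resL_glue, resR_glue, Matrix.mulVec_mulVec, hMM', Matrix.one_mulVec, glue_resL_resR] }
    have haL : ∀ x, aL x = glue e' (Mβ *ᵥ resL e' x) (resR e' x) := fun _ => rfl
    -- coordinates of single vectors along `e'`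
    have resL_single_inl : ∀ (i : Fin 2), resL e' (Pi.single (e' (Sum.inl i)) (1 : v.adicCompletion F)) = Pi.single i 1 := by
      intro i; funext i'
      rw [resL_apply, Pi.single_apply, Pi.single_apply]
      simp only [e'.apply_eq_iff_eq, Sum.inl.injEq]
    have resR_single_inl : ∀ (i : Fin 2), resR e' (Pi.single (e' (Sum.inl i)) (1 : v.adicCompletion F)) = 0 := by
      intro i; funext j
      rw [resR_apply, Pi.single_apply, Pi.zero_apply]
      simp only [e'.apply_eq_iff_eq, reduceCtorEq, if_false]
    have resL_single_inr : ∀ (j : ι₂), resL e' (Pi.single (e' (Sum.inr j)) (1 : v.adicCompletion F)) = 0 := by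
      intro j; funext i
      rw [resL_apply, Pi.single_apply, Pi.zero_apply]
      simp only [e'.apply_eq_iff_eq, reduceCtorEq, if_false]
    have resR_single_inr : ∀ (j : ι₂), resR e' (Pi.single (e' (Sum.inr j)) (1 : v.adicCompletion F)) = Pi.single j 1 := by
      intro j; funext j'
      rw [resR_apply, Pi.single_apply, Pi.single_apply]
      simp only [e'.apply_eq_iff_eq, Sum.inr.injEq]
    have glue_col : ∀ a₀ a₁ : v.adicCompletion F,
        glue e' ![a₀, a₁] (0 : ι₂ → v.adicCompletion F) =
          a₀ • Pi.single (e' (Sum.inl 0)) 1 + a₁ • Pi.single (e' (Sum.inl 1)) 1 := by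
      intro a₀ a₁; funext k
      obtain ⟨s, rfl⟩ := e'.surjective k
      rcases s with s | j
      · rw [glue_apply_inl]
        fin_cases s <;> simp [e'.apply_eq_iff_eq]
      · rw [glue_apply_inr]
        simp [e'.apply_eq_iff_eq]
    have glue_zero_single : ∀ j : ι₂, glue e' (0 : Fin 2 → v.adicCompletion F) (Pi.single j 1) = Pi.single (e' (Sum.inr j)) 1 := by
      intro j; funext k
      obtain ⟨s, rfl⟩ := e'.surjective k
      rcases s with s | j'
      · rw [glue_apply_inl]; simp [e'.apply_eq_iff_eq]
      · rw [glue_apply_inr]; simp [Pi.single_apply, e'.apply_eq_iff_eq]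
    -- hX: the conjugate acts on `X × 0` through `aL`
    set Dk := g₀ * (iota F E c N hcδ hδ hd T hT hJ v k : LocalSp F N T v) * g₀⁻¹ with hDk
    have hDk_apply : ∀ p, (Dk : ((Fin N → v.adicCompletion F) × (Fin N → v.adicCompletion F)) ≃ₗ[v.adicCompletion F] ((Fin N → v.adicCompletion F) × (Fin N → v.adicCompletion F))) p =
        (g₀ : ((Fin N → v.adicCompletion F) × (Fin N → v.adicCompletion F)) ≃ₗ[v.adicCompletion F] ((Fin N → v.adicCompletion F) × (Fin N → v.adicCompletion F))) (((iota F E c N hcδ hδ hd T hT hJ v k : LocalSp F N T v) : ((Fin N → v.adicCompletion F) × (Fin N → v.adicCompletion F)) ≃ₗ[v.adicCompletion F] ((Fin N → v.adicCompletion F) × (Fin N → v.adicCompletion F)))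
          ((g₀ : ((Fin N → v.adicCompletion F) × (Fin N → v.adicCompletion F)) ≃ₗ[v.adicCompletion F] ((Fin N → v.adicCompletion F) × (Fin N → v.adicCompletion F))).symm p)) := fun p => by
      rw [hDk, Subgroup.coe_mul, Subgroup.coe_mul, Subgroup.coe_inv, LinearEquiv.mul_apply, LinearEquiv.mul_apply,
        LinearEquiv.coe_inv]
    have hg₀x : ∀ i, (g₀ : ((Fin N → v.adicCompletion F) × (Fin N → v.adicCompletion F)) ≃ₗ[v.adicCompletion F] ((Fin N → v.adicCompletion F) × (Fin N → v.adicCompletion F))) (x' i) = (Pi.single i 1, 0) := fun i => apply_darboux_left g₀ hg₀ i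
    have hg₀y : ∀ j, (g₀ : ((Fin N → v.adicCompletion F) × (Fin N → v.adicCompletion F)) ≃ₗ[v.adicCompletion F] ((Fin N → v.adicCompletion F) × (Fin N → v.adicCompletion F))) (y' j) = (0, A⁻¹ *ᵥ Pi.single j 1) := fun j =>
      apply_darboux_right g₀ hg₀ hAd j
    have hg₀sx : ∀ i, (g₀ : ((Fin N → v.adicCompletion F) × (Fin N → v.adicCompletion F)) ≃ₗ[v.adicCompletion F] ((Fin N → v.adicCompletion F) × (Fin N → v.adicCompletion F))).symm (Pi.single i 1, 0) = x' i := fun i => by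
      rw [LinearEquiv.symm_apply_eq, hg₀x]
    have hX : ∀ x, (Dk : ((Fin N → v.adicCompletion F) × (Fin N → v.adicCompletion F)) ≃ₗ[v.adicCompletion F] ((Fin N → v.adicCompletion F) × (Fin N → v.adicCompletion F))) (x, 0) = (aL x, 0) := by
      -- both sides are linear in `x`; compare on the basis `Pi.single l 1`
      let L₁ : (Fin N → v.adicCompletion F) →ₗ[v.adicCompletion F] (Fin N → v.adicCompletion F) × (Fin N → v.adicCompletion F) :=
        (Dk : ((Fin N → v.adicCompletion F) × (Fin N → v.adicCompletion F)) ≃ₗ[v.adicCompletion F] ((Fin N → v.adicCompletion F) × (Fin N → v.adicCompletion F))).toLinearMap ∘ₗ LinearMap.inl (v.adicCompletion F) _ _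
      let L₂ : (Fin N → v.adicCompletion F) →ₗ[v.adicCompletion F] (Fin N → v.adicCompletion F) × (Fin N → v.adicCompletion F) :=
        LinearMap.inl (v.adicCompletion F) _ _ ∘ₗ aL.toLinearMap
      suffices h : L₁ = L₂ by
        intro x
        have := LinearMap.congr_fun h x
        exact this
      refine (Pi.basisFun (v.adicCompletion F) (Fin N)).ext fun l => ?_
      change (Dk : ((Fin N → v.adicCompletion F) × (Fin N → v.adicCompletion F)) ≃ₗ[v.adicCompletion F] ((Fin N → v.adicCompletion F) × (Fin N → v.adicCompletion F))) (Pi.basisFun (v.adicCompletion F) (Fin N) l, 0) = (aL (Pi.basisFun (v.adicCompletion F) (Fin N) l), 0)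
      rw [Pi.basisFun_apply, hDk_apply, hg₀sx, haL]
      obtain ⟨s, rfl⟩ := e'.surjective l
      rcases s with s | j
      · fin_cases s
        · rw [Fin.zero_eta, hkx0, map_add, map_smul, map_smul, hg₀x, hg₀x, resL_single_inl, resR_single_inl,
            Matrix.mulVec_single_one]
          refine Prod.ext ?_ (by simp)
          simp only [Prod.fst_add, Prod.smul_fst, Fin.isValue]
          rw [← glue_col]
          congr 1
          funext i; fin_cases i <;> rfl
        · rw [Fin.mk_one, hkx1, map_add, map_smul, map_smul, hg₀x, hg₀x, resL_single_inl, resR_single_inl,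
            Matrix.mulVec_single_one]
          refine Prod.ext ?_ (by simp)
          simp only [Prod.fst_add, Prod.smul_fst, Fin.isValue]
          rw [← glue_col]
          congr 1
          funext i; fin_cases i <;> rfl
      · rw [hkxj, hg₀x, resL_single_inr, resR_single_inr, Matrix.mulVec_zero, glue_zero_single]
    have hY : ∀ y, ((Dk : ((Fin N → v.adicCompletion F) × (Fin N → v.adicCompletion F)) ≃ₗ[v.adicCompletion F] ((Fin N → v.adicCompletion F) × (Fin N → v.adicCompletion F))) (0, y)).1 = 0 := by
      intro y
      rw [hDk_apply, symm_apply_inr_of_darboux g₀ hg₀ y, map_sum, map_sum, Prod.fst_sum]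
      refine Finset.sum_eq_zero fun j _ => ?_
      rw [map_smul, map_smul, Prod.smul_fst]
      obtain ⟨s, rfl⟩ := e'.surjective j
      obtain ⟨a₀, a₁, hs⟩ := hky s
      rw [hs, map_add, map_add, map_smul, map_smul, hg₀y, hg₀y]
      split_ifs with hj
      · rw [hg₀y]; simp
      · simp
    obtain ⟨dY, had, hDk_eq, -⟩ := exists_eq_leviSp_of_apply_inl (localPairing F N T v) Dk aL hX hY
    exact ⟨aL, dY, had, hDk_eq, haL⟩

end Mover

end Literature.NumberTheory.Automorphic.UnitaryGroup

end
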